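import Literature.MathematicalPhysics.QuantumFieldTheory.QCDOS
import Literature.MathematicalPhysics.QuantumLattice.SchwartzOrderedWedgeDensity
import Literature.MathematicalPhysics.QuantumLattice.SchwingerOSCluster
import HarnessLib

/-!
# The mass-gap clause of OS data is determined by the time-ordered Schwinger functions;
# the continuum gap clause of QCD depends only on the scheme

Theorem-only Literature file (topic `MathematicalPhysics/QuantumFieldTheory`).

* `exists_translateMulti_appendTensor_osAdjoint_mem_slabOrderedProducts` — for slab-ordered real
  product tensors `P`, `Q` (`slabOrderedProducts`, the elementary tensors of OS's `𝒮_<`) and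
  `t ≥ 0`, a forward time translate of `ΘP* ⊗ T_t Q` is again a slab-ordered real product tensor
  (in `n + m` variables); in particular it is time-ordered.
* `OSData.schwinger_appendTensor_osAdjoint_eq_of_eqOn_isTimeOrdered`,
  `OSData.hasMassGap_of_eqOn_isTimeOrdered`, `OSData.hasMassGap_iff_of_eqOn_isTimeOrdered` — two
  OS data whose Schwinger functions agree on all TIME-ORDERED test functions in every degree
  `n ≥ 1` take the same values on every test function read by the mass-gap clause
  (`ΘF* ⊗ T_t G`, `ΘF*`, `G`), hence have the same mass gaps (`OSData.HasMassGap`). Ingredients: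
  the ordered-wedge density `IsTimeOrdered.mem_closure_span_slabOrderedProducts`, continuity of
  `(F, G) ↦ ΘF* ⊗ G` on `𝓢 × 𝓢`, E1 (translations) on `⁰𝒮`, E0 (normalisation, hermiticity).
* `IsQCDAlong.schwinger_eq_of_isTimeOrdered`, `IsQCDAlong.hasMassGap_iff` — OS data that are QCD
  along the SAME scheme (`IsQCDAlong sch`) agree on all time-ordered test functions (`n ≥ 1`:
  both are the limit of the same lattice `n`-point functions on slab-ordered real product
  tensors, which are off-diagonal real tensors), hence the continuum gap clause
  `T.HasMassGap Δ` of `QCDOf` has the same truth value for all OS data along one scheme: it is a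
  property of the scheme. Consequence for the support item `GapTransfer` (uniform lattice gap +
  `IsQCDAlong` ⇒ continuum gap): it cannot be refuted by re-choosing the OS data `T` off the real
  off-diagonal tensors pinned by `IsQCDAlong`.

References: K. Osterwalder, R. Schrader, CMP 31 (1973), §2 (the spaces `𝒮_<`, `𝒮₊` and their
tensor-product structure), §3 (E0, E1); J. Glimm, A. Jaffe, *Quantum Physics* (1987), §6.1.
-/

open scoped SchwartzMap ComplexConjugate
open Filter Topology Complex Set
open Literature.MathematicalPhysics.AQFT Literature.MathematicalPhysics.QuantumLattice

noncomputable section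

namespace Literature.MathematicalPhysics.QuantumFieldTheory

variable {d : ℕ} [NeZero d] {n m : ℕ}

/-! ### Translated reflected slab products are slab products -/

/-- **Forward translates of `ΘP* ⊗ T_t Q` are slab-ordered.** For slab-ordered real product
tensors `P` (in `n` variables) and `Q` (in `m` variables) and `t ≥ 0` there is a time `s` such
that `T_s (ΘP* ⊗ T_t Q)` is a slab-ordered real product tensor in `n + m` variables: the factors
of `ΘP*` are the time-reflected factors of `P` in reversed order (OS 1973 §2, (2.4)), supported in
the negative slabs `[-hi, -lo]`, which `s = 1 + ∑ hi` moves into positive, still ordered, slabs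
lying below the slabs `s + t + [lo', hi']` of `T_{s+t} Q`. [cite: OsterwalderSchraderCMP1973, §2 pp. 86–87] -/
theorem exists_translateMulti_appendTensor_osAdjoint_mem_slabOrderedProducts
    {P : 𝓢((Fin n → EuclideanSpace ℝ (Fin d)), ℂ)} {Q : 𝓢((Fin m → EuclideanSpace ℝ (Fin d)), ℂ)}
    (hP : P ∈ slabOrderedProducts d n) (hQ : Q ∈ slabOrderedProducts d m) {t : ℝ} (ht : 0 ≤ t) :
    ∃ s : ℝ, translateMulti (EuclideanSpace.single 0 s)
        ((osAdjoint P).appendTensor (translateMulti (EuclideanSpace.single 0 t) Q)) ∈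
      slabOrderedProducts d (n + m) := by
  obtain ⟨f, lo, hi, hPf, hlo, hle, hord, hsupp⟩ := hP
  obtain ⟨g, lo', hi', hQg, hlo', hle', hord', hsupp'⟩ := hQ
  set s : ℝ := 1 + ∑ i, hi i with hs
  have hhi0 : ∀ i, 0 ≤ hi i := fun i => (hlo i).le.trans (hle i)
  have hhis : ∀ i, hi i < s := fun i => by
    have h := Finset.single_le_sum (f := hi) (fun j _ => hhi0 j) (Finset.mem_univ i)
    linarith
  have hs1 : 1 ≤ s := by
    have h := Finset.sum_nonneg fun j (_ : j ∈ (Finset.univ : Finset (Fin n))) => hhi0 j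
    linarith
  refine ⟨s, Fin.append (fun i => translateTest (EuclideanSpace.single 0 s) (thetaTest d (f (Fin.rev i))))
      (fun j => translateTest (EuclideanSpace.single 0 s)
        (translateTest (EuclideanSpace.single 0 t) (g j))),
    Fin.append (fun i => s - hi (Fin.rev i)) (fun j => s + t + lo' j),
    Fin.append (fun i => s - lo (Fin.rev i)) (fun j => s + t + hi' j), ?_, ?_, ?_, ?_, ?_⟩
  · -- the tensor structure, from the tree's `IsTensorOf` calculus
    have h1 : IsTensorOf (osAdjoint P) fun i => ofRealTest (thetaTest d (f (Fin.rev i))) :=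
      hPf.osAdjoint
    have h2 : IsTensorOf (translateMulti (EuclideanSpace.single 0 t) Q)
        fun j => ofRealTest (translateTest (EuclideanSpace.single 0 t) (g j)) :=
      hQg.translateMulti _
    have h3 := h1.appendTensor h2
    have hA : Fin.append (fun i => ofRealTest (thetaTest d (f (Fin.rev i))))
        (fun j => ofRealTest (translateTest (EuclideanSpace.single 0 t) (g j))) =
        fun k => ofRealTest (Fin.append (fun i => thetaTest d (f (Fin.rev i)))
          (fun j => translateTest (EuclideanSpace.single 0 t) (g j)) k) :=
      append_ofRealTest _ _
    rw [hA] at h3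
    have h4 := h3.translateMulti (EuclideanSpace.single 0 s)
    have hfam : (fun k => ofRealTest (Fin.append
        (fun i => translateTest (EuclideanSpace.single 0 s) (thetaTest d (f (Fin.rev i))))
        (fun j => translateTest (EuclideanSpace.single 0 s)
          (translateTest (EuclideanSpace.single 0 t) (g j))) k)) =
        fun k => ofRealTest (translateTest (EuclideanSpace.single 0 s)
          (Fin.append (fun i => thetaTest d (f (Fin.rev i)))
            (fun j => translateTest (EuclideanSpace.single 0 t) (g j)) k)) := by
      funext k
      induction k using Fin.addCases with
      | left i => simp
      | right j => simp
    rw [hfam]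
    exact h4
  · -- the slabs are positive
    intro k
    induction k using Fin.addCases with
    | left i => simp only [Fin.append_left]; linarith [hhis (Fin.rev i)]
    | right j => simp only [Fin.append_right]; linarith [hlo' j]
  · -- `lo ≤ hi`
    intro k
    induction k using Fin.addCases with
    | left i => simp only [Fin.append_left]; linarith [hle (Fin.rev i)]
    | right j => simp only [Fin.append_right]; linarith [hle' j]
  · -- the slabs are ordered
    intro a b hab
    induction a using Fin.addCases with
    | left i =>
      induction b using Fin.addCases with
      | left i' =>
        simp only [Fin.append_left]
        have hii' : i < i' := by
          have h := Fin.lt_def.1 hab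
          simp only [Fin.val_castAdd] at h
          exact Fin.lt_def.2 h
        have h := hord (Fin.rev i') (Fin.rev i) (Fin.rev_lt_rev.2 hii')
        linarith
      | right j' =>
        simp only [Fin.append_left, Fin.append_right]
        linarith [hlo (Fin.rev i), hlo' j']
    | right j =>
      induction b using Fin.addCases with
      | left i' =>
        exfalso
        have h : (n + (j : ℕ)) < (i' : ℕ) := by
          have h := Fin.lt_def.1 hab
          simpa only [Fin.val_castAdd, Fin.val_natAdd] using h
        have := i'.isLt
        omega
      | right j' =>
        simp only [Fin.append_right]
        have hjj' : j < j' := by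
          have h := Fin.lt_def.1 hab
          simp only [Fin.val_natAdd, add_lt_add_iff_left] at h
          exact Fin.lt_def.2 h
        linarith [hord' j j' hjj']
  · -- the supports
    intro k
    induction k using Fin.addCases with
    | left i =>
      simp only [Fin.append_left]
      intro x hx
      have hφ : Continuous fun x : EuclideanSpace ℝ (Fin d) =>
          timeReflection d (x - EuclideanSpace.single 0 s) :=
        (timeReflection d).continuous.comp (continuous_id.sub continuous_const)
      have hfun : ((translateTest (EuclideanSpace.single 0 s) (thetaTest d (f (Fin.rev i))) :
          𝓢(EuclideanSpace ℝ (Fin d), ℝ)) : EuclideanSpace ℝ (Fin d) → ℝ) =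
          (f (Fin.rev i) : EuclideanSpace ℝ (Fin d) → ℝ) ∘
            fun x : EuclideanSpace ℝ (Fin d) => timeReflection d (x - EuclideanSpace.single 0 s) := by
        funext x; simp
      rw [hfun] at hx
      have hx' := hsupp (Fin.rev i) (tsupport_comp_subset_preimage _ hφ hx)
      simp only [Set.mem_setOf_eq, timeReflection_apply, PiLp.sub_apply] at hx'
      simp at hx'
      constructor <;> linarith [hx'.1, hx'.2]
    | right j =>
      simp only [Fin.append_right]
      intro x hx
      have hφ : Continuous fun x : EuclideanSpace ℝ (Fin d) =>
          x - EuclideanSpace.single 0 s - EuclideanSpace.single 0 t :=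
        (continuous_id.sub continuous_const).sub continuous_const
      have hfun : ((translateTest (EuclideanSpace.single 0 s)
          (translateTest (EuclideanSpace.single 0 t) (g j)) : 𝓢(EuclideanSpace ℝ (Fin d), ℝ)) :
            EuclideanSpace ℝ (Fin d) → ℝ) =
          (g j : EuclideanSpace ℝ (Fin d) → ℝ) ∘
            fun x : EuclideanSpace ℝ (Fin d) =>
              x - EuclideanSpace.single 0 s - EuclideanSpace.single 0 t := by
        funext x; simp
      rw [hfun] at hx
      have hx' := hsupp' j (tsupport_comp_subset_preimage _ hφ hx)
      simp only [Set.mem_setOf_eq, PiLp.sub_apply] at hx'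
      simp at hx'
      constructor <;> linarith [hx'.1, hx'.2]

/-- **Forward translates of `ΘP* ⊗ T_t Q` are time-ordered** (`P`, `Q` slab-ordered real product
tensors, `t ≥ 0`). [cite: OsterwalderSchraderCMP1973, §2 pp. 86–87] -/
theorem exists_isTimeOrdered_translateMulti_appendTensor_osAdjoint
    {P : 𝓢((Fin n → EuclideanSpace ℝ (Fin d)), ℂ)} {Q : 𝓢((Fin m → EuclideanSpace ℝ (Fin d)), ℂ)}
    (hP : P ∈ slabOrderedProducts d n) (hQ : Q ∈ slabOrderedProducts d m) {t : ℝ} (ht : 0 ≤ t) :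
    ∃ s : ℝ, IsTimeOrdered (translateMulti (EuclideanSpace.single 0 s)
        ((osAdjoint P).appendTensor (translateMulti (EuclideanSpace.single 0 t) Q))) := by
  obtain ⟨s, hs⟩ := exists_translateMulti_appendTensor_osAdjoint_mem_slabOrderedProducts hP hQ ht
  exact ⟨s, IsTimeOrdered.of_mem_slabOrderedProducts hs⟩

/-! ### Two OS data agreeing on time-ordered test functions have the same mass gaps -/

namespace OSData

variable {ι : Type}

/-- **The mass-gap test functions are pinned by the time-ordered Schwinger functions.** If the
Schwinger functions of two OS data agree on all time-ordered test functions in every degree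
`n ≥ 1`, then they agree on `ΘF* ⊗ T_t G` for all time-ordered `F`, `G` and `t ≥ 0` (the test
functions of E2, E4 and of the mass-gap clause). Proof: by E0 (normalisation) if `n + m = 0`;
otherwise both sides are continuous in `(F, G)`, sesquilinear, and by the ordered-wedge density
(`IsTimeOrdered.mem_closure_span_slabOrderedProducts`) it suffices to treat slab-ordered real
product tensors `P`, `Q`, for which a forward time translate of `ΘP* ⊗ T_t Q` is time-ordered
and E1 (translation invariance on `⁰𝒮`) moves both sides there. [cite: OsterwalderSchraderCMP1973, §2 pp. 86–87 and §3 (E0), (E1)] -/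
theorem schwinger_appendTensor_osAdjoint_eq_of_eqOn_isTimeOrdered {T T' : OSData ι d}
    (h : ∀ n : ℕ, n ≠ 0 → ∀ (k : Fin n → ι) (F : 𝓢((Fin n → EuclideanSpace ℝ (Fin d)), ℂ)),
      IsTimeOrdered F → T.schwinger n k F = T'.schwinger n k F)
    (lab : Fin (n + m) → ι) {F : 𝓢((Fin n → EuclideanSpace ℝ (Fin d)), ℂ)}
    {G : 𝓢((Fin m → EuclideanSpace ℝ (Fin d)), ℂ)} (hF : IsTimeOrdered F) (hG : IsTimeOrdered G)
    {t : ℝ} (ht : 0 ≤ t) :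
    T.schwinger (n + m) lab ((osAdjoint F).appendTensor (translateMulti (EuclideanSpace.single 0 t) G)) =
      T'.schwinger (n + m) lab
        ((osAdjoint F).appendTensor (translateMulti (EuclideanSpace.single 0 t) G)) := by
  rcases Nat.eq_zero_or_pos (n + m) with hnm | hnm
  · obtain ⟨rfl, rfl⟩ : n = 0 ∧ m = 0 := by omega
    exact (T.normalized lab _).trans (T'.normalized lab _).symm
  -- the difference functional
  set D : 𝓢((Fin (n + m) → EuclideanSpace ℝ (Fin d)), ℂ) →L[ℂ] ℂ :=
    T.schwinger (n + m) lab - T'.schwinger (n + m) lab with hD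
  -- notation for the test function of the clause
  let X : 𝓢((Fin n → EuclideanSpace ℝ (Fin d)), ℂ) → 𝓢((Fin m → EuclideanSpace ℝ (Fin d)), ℂ) →
      𝓢((Fin (n + m) → EuclideanSpace ℝ (Fin d)), ℂ) :=
    fun P Q => (osAdjoint P).appendTensor (translateMulti (EuclideanSpace.single 0 t) Q)
  -- step 0: generators
  have h0 : ∀ P ∈ slabOrderedProducts d n, ∀ Q ∈ slabOrderedProducts d m, D (X P Q) = 0 := by
    intro P hP Q hQ
    obtain ⟨s, hY⟩ := exists_isTimeOrdered_translateMulti_appendTensor_osAdjoint hP hQ ht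
    have hYod := hY.isOffDiagonal
    have hback : translateMulti (-EuclideanSpace.single (0 : Fin d) s)
        (translateMulti (EuclideanSpace.single 0 s) (X P Q)) = X P Q := by
      ext x
      simp only [translateMulti_apply, sub_neg_eq_add, add_sub_cancel_right]
    have e1 := T.invariant.translateMulti (n + m) lab (-EuclideanSpace.single (0 : Fin d) s) _ hYod
    have e2 := T'.invariant.translateMulti (n + m) lab (-EuclideanSpace.single (0 : Fin d) s) _ hYod
    rw [hback] at e1 e2
    have e3 := h (n + m) hnm.ne' lab _ hY
    simp only [hD, FunLike.coe_sub, Pi.sub_apply, e1, e2, e3, sub_self]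
  -- step 1: linear span in `Q`
  have h1 : ∀ P ∈ slabOrderedProducts d n, ∀ Q ∈ Submodule.span ℂ (slabOrderedProducts d m),
      D (X P Q) = 0 := by
    intro P hP Q hQ
    induction hQ using Submodule.span_induction with
    | mem Q hQ => exact h0 P hP Q hQ
    | zero =>
      have h00 : X P 0 = 0 := by ext x; simp [X, SchwartzMap.appendTensor_apply]
      rw [h00, map_zero]
    | add Q Q' _ _ hQ hQ' =>
      simp only [X, map_add, SchwartzMap.appendTensor_add_right] at hQ hQ' ⊢
      rw [hQ, hQ', add_zero]
    | smul c Q _ hQ =>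
      simp only [X, map_smul, SchwartzMap.appendTensor_smul_right, smul_eq_mul] at hQ ⊢
      rw [hQ, mul_zero]
  -- step 2: closure in `Q` (reaches the time-ordered `G`)
  have h2 : ∀ P ∈ slabOrderedProducts d n, D (X P G) = 0 := by
    intro P hP
    have hcont : Continuous fun Q : 𝓢((Fin m → EuclideanSpace ℝ (Fin d)), ℂ) => D (X P Q) :=
      D.continuous.comp (continuous_appendTensor.comp
        (continuous_const.prodMk (translateMulti (EuclideanSpace.single (0 : Fin d) t)).continuous))
    have hclosed : IsClosed {Q : 𝓢((Fin m → EuclideanSpace ℝ (Fin d)), ℂ) | D (X P Q) = 0} :=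
      isClosed_eq hcont continuous_const
    exact closure_minimal (fun Q hQ => h1 P hP Q hQ) hclosed hG.mem_closure_span_slabOrderedProducts
  -- step 3: linear span in `P`
  have h3 : ∀ P ∈ Submodule.span ℂ (slabOrderedProducts d n), D (X P G) = 0 := by
    intro P hP
    induction hP using Submodule.span_induction with
    | mem P hP => exact h2 P hP
    | zero =>
      have : X 0 G = 0 := by ext x; simp [X, SchwartzMap.appendTensor_apply]
      rw [this, map_zero]
    | add P P' _ _ hP hP' =>
      simp only [X, osAdjoint_add, SchwartzMap.appendTensor_add_left, map_add] at hP hP' ⊢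
      rw [hP, hP', add_zero]
    | smul c P _ hP =>
      simp only [X, osAdjoint_smul, SchwartzMap.appendTensor_smul_left, map_smul, smul_eq_mul] at hP ⊢
      rw [hP, mul_zero]
  -- step 4: closure in `P` (reaches the time-ordered `F`)
  have h4 : D (X F G) = 0 := by
    have hcont : Continuous fun P : 𝓢((Fin n → EuclideanSpace ℝ (Fin d)), ℂ) => D (X P G) :=
      D.continuous.comp (continuous_appendTensor.comp (continuous_osAdjoint.prodMk continuous_const))
    have hclosed : IsClosed {P : 𝓢((Fin n → EuclideanSpace ℝ (Fin d)), ℂ) | D (X P G) = 0} :=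
      isClosed_eq hcont continuous_const
    exact closure_minimal (fun P hP => h3 P hP) hclosed hF.mem_closure_span_slabOrderedProducts
  simpa [hD, X, sub_eq_zero] using h4

/-- **Agreement on time-ordered test functions transports the mass gap.** If the Schwinger
functions of `T` and `T'` agree on all time-ordered test functions in every degree `n ≥ 1`, then
every mass gap of `T` is a mass gap of `T'` (`OSData.HasMassGap`: all three Schwinger-function
values in the clustering bound coincide — the joint one by
`schwinger_appendTensor_osAdjoint_eq_of_eqOn_isTimeOrdered`, `𝔖(ΘF*)` by E0-hermiticity, `𝔖(G)`
directly, degree `0` by E0-normalisation). [cite: OsterwalderSchraderCMP1973, §2 pp. 86–87 and §3 (E0), (E1)] -/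
theorem hasMassGap_of_eqOn_isTimeOrdered {T T' : OSData ι d}
    (h : ∀ n : ℕ, n ≠ 0 → ∀ (k : Fin n → ι) (F : 𝓢((Fin n → EuclideanSpace ℝ (Fin d)), ℂ)),
      IsTimeOrdered F → T.schwinger n k F = T'.schwinger n k F)
    {Δ : ℝ} (hT : T.HasMassGap Δ) : T'.HasMassGap Δ := by
  intro n m k k' F G hF hG
  obtain ⟨C, hC⟩ := hT n m k k' F G hF hG
  refine ⟨C, fun t ht H hH => ?_⟩
  have hHeq : H = (osAdjoint F).appendTensor (translateMulti (EuclideanSpace.single 0 t) G) := by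
    ext x
    rw [hH x, SchwartzMap.appendTensor_apply]
  have e1 : T'.schwinger (n + m) (Fin.append (k ∘ Fin.rev) k') H =
      T.schwinger (n + m) (Fin.append (k ∘ Fin.rev) k') H := by
    rw [hHeq]
    exact (schwinger_appendTensor_osAdjoint_eq_of_eqOn_isTimeOrdered h _ hF hG ht).symm
  have e2 : T'.schwinger m k' G = T.schwinger m k' G := by
    rcases Nat.eq_zero_or_pos m with rfl | hm
    · exact (T'.normalized k' G).trans (T.normalized k' G).symm
    · exact (h m hm.ne' k' G hG).symm
  have e3 : T'.schwinger n (k ∘ Fin.rev) (osAdjoint F) = T.schwinger n (k ∘ Fin.rev) (osAdjoint F) := by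
    rcases Nat.eq_zero_or_pos n with rfl | hn
    · exact (T'.normalized _ _).trans (T.normalized _ _).symm
    · have f1 : T.schwinger n (k ∘ Fin.rev) (osAdjoint F) = conj (T.schwinger n k F) := by
        rw [T.hermitian n k F hF, conj_conj]
      have f2 : T'.schwinger n (k ∘ Fin.rev) (osAdjoint F) = conj (T'.schwinger n k F) := by
        rw [T'.hermitian n k F hF, conj_conj]
      rw [f1, f2, h n hn.ne' k F hF]
  rw [e1, e2, e3]
  exact hC t ht H hH

/-- **OS data agreeing on time-ordered test functions have the same mass gaps.** [cite: OsterwalderSchraderCMP1973, §2 pp. 86–87 and §3 (E0), (E1)] -/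
theorem hasMassGap_iff_of_eqOn_isTimeOrdered {T T' : OSData ι d}
    (h : ∀ n : ℕ, n ≠ 0 → ∀ (k : Fin n → ι) (F : 𝓢((Fin n → EuclideanSpace ℝ (Fin d)), ℂ)),
      IsTimeOrdered F → T.schwinger n k F = T'.schwinger n k F)
    (Δ : ℝ) : T.HasMassGap Δ ↔ T'.HasMassGap Δ :=
  ⟨hasMassGap_of_eqOn_isTimeOrdered h,
    hasMassGap_of_eqOn_isTimeOrdered fun n hn k F hF => (h n hn k F hF).symm⟩

end OSData

/-! ### QCD: the continuum gap clause depends only on the scheme -/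

/-- **OS data that are QCD along the same scheme agree on all time-ordered test functions**
(degree `n ≥ 1`, every species string): on slab-ordered real product tensors — which are
off-diagonal real tensors — both are the limit of the same sequence of lattice `n`-point
functions (`IsQCDAlong`, uniqueness of limits), and these tensors are total among the
time-ordered test functions (`IsTimeOrdered.mem_closure_span_slabOrderedProducts`) for the
continuous linear functionals `T.schwinger n σ`, `T'.schwinger n σ`. [folklore] -/
theorem IsQCDAlong.schwinger_eq_of_isTimeOrdered {Nf : ℕ} {sch : QCDScheme Nf}
    {T T' : OSData (QCDField Nf) 4} (hT : IsQCDAlong sch T) (hT' : IsQCDAlong sch T')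
    {n : ℕ} (hn : n ≠ 0) (σ : Fin n → QCDField Nf)
    {F : 𝓢((Fin n → EuclideanSpace ℝ (Fin 4)), ℂ)} (hF : IsTimeOrdered F) :
    T.schwinger n σ F = T'.schwinger n σ F := by
  have key : ∀ P ∈ slabOrderedProducts 4 n, T.schwinger n σ P = T'.schwinger n σ P := by
    intro P hP
    have hod : IsOffDiagonal P := (IsTimeOrdered.of_mem_slabOrderedProducts hP).isOffDiagonal
    obtain ⟨f, lo, hi, hPf, -, -, -, -⟩ := hP
    exact tendsto_nhds_unique (hT.2.2 n hn σ f P hPf hod) (hT'.2.2 n hn σ f P hPf hod)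
  set D : 𝓢((Fin n → EuclideanSpace ℝ (Fin 4)), ℂ) →L[ℂ] ℂ := T.schwinger n σ - T'.schwinger n σ
    with hD
  have hspan : ∀ P ∈ Submodule.span ℂ (slabOrderedProducts 4 n), D P = 0 := by
    intro P hP
    induction hP using Submodule.span_induction with
    | mem P hP => simp [hD, key P hP]
    | zero => simp
    | add P P' _ _ hP hP' => rw [map_add, hP, hP', add_zero]
    | smul c P _ hP => rw [map_smul, hP, smul_zero]
  have hclosed : IsClosed {P : 𝓢((Fin n → EuclideanSpace ℝ (Fin 4)), ℂ) | D P = 0} :=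
    isClosed_eq D.continuous continuous_const
  have hmem : D F = 0 :=
    closure_minimal (fun P hP => hspan P hP) hclosed hF.mem_closure_span_slabOrderedProducts
  simpa [hD, sub_eq_zero] using hmem

/-- **The continuum gap clause of QCD is a property of the scheme**: for OS data `T`, `T'` that
are QCD along the same scheme, `T.HasMassGap Δ ↔ T'.HasMassGap Δ` for every `Δ`. In particular
the support item "uniform lattice gap + `IsQCDAlong` ⇒ continuum gap" (`GapTransfer`) is decided
scheme by scheme, and cannot be refuted by modifying the OS data off the off-diagonal real
product tensors on which `IsQCDAlong` pins them. [folklore] -/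
theorem IsQCDAlong.hasMassGap_iff {Nf : ℕ} {sch : QCDScheme Nf} {T T' : OSData (QCDField Nf) 4}
    (hT : IsQCDAlong sch T) (hT' : IsQCDAlong sch T') (Δ : ℝ) :
    T.HasMassGap Δ ↔ T'.HasMassGap Δ :=
  OSData.hasMassGap_iff_of_eqOn_isTimeOrdered
    (fun _ hn k _ hF => hT.schwinger_eq_of_isTimeOrdered hT' hn k hF) Δ

/-- **Witness-independence of the gap clause along a scheme**: if SOME OS data along `sch` have
the mass gap `Δ`, then ALL OS data along `sch` have it. [folklore] -/
theorem IsQCDAlong.hasMassGap_of_exists {Nf : ℕ} {sch : QCDScheme Nf} {T : OSData (QCDField Nf) 4}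
    (hT : IsQCDAlong sch T) {Δ : ℝ} (h : ∃ T' : OSData (QCDField Nf) 4, IsQCDAlong sch T' ∧ T'.HasMassGap Δ) :
    T.HasMassGap Δ := by
  obtain ⟨T', hT', hgap⟩ := h
  exact (hT'.hasMassGap_iff hT Δ).1 hgap

end Literature.MathematicalPhysics.QuantumFieldTheory

end
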